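import Mathlib
import HarnessLib
import Summits.CriticalPhenomena.CardyFormulaZ2.Theorems.CardyMagicRigidityMagicFormulaTCoefficientExchange
import Summits.CriticalPhenomena.CardyFormulaZ2.Theorems.CardyMagicRigidityMagicFormulaTCoefficientFormulas

/-!
# Line `Sketch` (v9) for crux `MagicFormulaT`, sub-goal SO `so_secondOrder_of_twoPoint`:
# order `2` of the coefficient identification reduces to the two-point power-sum limit

Crux `Summit.CriticalPhenomena.CardyFormulaZ2.Theses.CardyMagicRigidity.MagicFormulaT`
(stmt-CriticalPhenomena-4836), line `Sketch`, skeleton v9, wave-3 sub-goal SO.  For an admissible density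
`f` (`|f| ≤ C`, `f = 0` off `B̄(0, R)`, `∫ f = 0`) write `θ_u = u.nestingPhase f` for the loops `u` of
`siteLoopConfig δ ω`, `A₁ = Σᶠ_u θ_u`, `A₂ = Σᶠ_u θ_u²`, `Φ_δ(t) = E_{1/2}[∏ᶠ_u 2cos(t θ_u + π/3)]` and
`G_f(t) = exp(q(f) t²)` with `q(f) = (3/4π²) ∬ log‖x − y‖ f(x) f(y)`.  If
`E_{1/2}[3A₁² − 4A₂] → (3/2π²) ∬ log‖x − y‖ f(x) f(y)` as `δ → 0⁺`, then every limit `a` of `Φ_δ''(0)`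
along `δ → 0⁺` equals `G_f''(0)`.

Proof.  For `δ > 0`, `Φ_δ''(0) = E_{1/2}[∂_t² ∏ᶠ_u 2cos(t θ_u + π/3) |_{t=0}]`
(`cf_iteratedDeriv_eq_integral`) `= E_{1/2}[3A₁² − 4A₂]` (pathwise, `cf_iteratedDeriv_two_finprod` with the
finiteness of the loops meeting the ball, `ncard_loops_siteLoopConfig_meeting_le`), a real number
(`integral_complex_ofReal`).  Hence `Φ_δ''(0) → (3/2π²) ∬ …` in `ℂ` along `𝓝[>] 0`, and by uniqueness of
limits `a = (3/2π²) ∬ …`.  Finally `G_f''(0) = 2 q(f)` by two explicit differentiations of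
`t ↦ exp(c t²)`.  No named fact is used; no definition is introduced.
-/

noncomputable section

namespace Summit.CriticalPhenomena.CardyFormulaZ2.Cruxes.MagicFormulaT.LineSketch

open MeasureTheory Filter Set
open scoped Real Topology BigOperators ENNReal
open Literature.Probability.RandomPlanarGeometry Literature.Probability.Percolation
  Literature.Probability.LatticeModels

/-! ## The Gaussian side: `(exp(c t²))''(0) = 2c` -/

/-- The derivative of `t ↦ exp(c t²)` is `t ↦ exp(c t²) · (2 c t)` (chain rule). -/
theorem so_hasDerivAt_cexp_mul_sq (c t : ℂ) :
    HasDerivAt (fun s : ℂ ↦ Complex.exp (c * s ^ 2)) (Complex.exp (c * t ^ 2) * (2 * c * t)) t := by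
  refine ((hasDerivAt_pow 2 t).const_mul c).cexp.congr_deriv ?_
  rw [Nat.cast_ofNat, Nat.add_one_sub_one, pow_one]
  ring

/-- `(exp(c t²))''(0) = 2c`: differentiate `exp(c t²) · (2 c t)` once more at `t = 0` (product rule; the
first factor has derivative `0` there and value `1`). -/
theorem so_iteratedDeriv_two_cexp_mul_sq (c : ℂ) :
    iteratedDeriv 2 (fun t : ℂ ↦ Complex.exp (c * t ^ 2)) 0 = 2 * c := by
  have hd : deriv (fun t : ℂ ↦ Complex.exp (c * t ^ 2)) =
      fun t ↦ Complex.exp (c * t ^ 2) * (2 * c * t) :=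
    funext fun t ↦ (so_hasDerivAt_cexp_mul_sq c t).deriv
  have hl : HasDerivAt (fun t : ℂ ↦ 2 * c * t) (2 * c) 0 := by
    simpa using (hasDerivAt_id (0 : ℂ)).const_mul (2 * c)
  have h2 : HasDerivAt (fun t : ℂ ↦ Complex.exp (c * t ^ 2) * (2 * c * t)) (2 * c) 0 := by
    refine ((so_hasDerivAt_cexp_mul_sq c 0).fun_mul hl).congr_deriv ?_
    simp
  rw [iteratedDeriv_succ, iteratedDeriv_one, hd, h2.deriv]

/-! ## The percolation side: `Φ_δ''(0)` is the expectation of the real statistic `3A₁² − 4A₂` -/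

/-- For `δ > 0` and admissible `f`: `Φ_δ''(0) = E_{1/2}[3A₁² − 4A₂]` (as a complex number), by the exchange
of derivatives with the expectation (`cf_iteratedDeriv_eq_integral`) and the pathwise coefficient formula
(`cf_iteratedDeriv_two_finprod`, finitely many loops meet `B̄(0, R)` at fixed mesh). -/
theorem so_iteratedDeriv_two_eq_ofReal_integral {f : ℂ → ℝ} {R C : ℝ} (hf : Measurable f)
    (hC : ∀ z, |f z| ≤ C) (hR : ∀ z, R < ‖z‖ → f z = 0) (h0 : ∫ z, f z = 0) {δ : ℝ} (hδ : 0 < δ) :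
    iteratedDeriv 2 (fun t : ℂ ↦ ∫ ω, (∏ᶠ u ∈ (siteLoopConfig δ ω).loops,
      2 * Complex.cos (t * ((u.nestingPhase f : ℝ) : ℂ) + (Real.pi : ℂ) / 3)) ∂(triSitePercolation half)) 0 =
    ((∫ ω, (3 * (∑ᶠ u ∈ (siteLoopConfig δ ω).loops, u.nestingPhase f) ^ 2 -
      4 * (∑ᶠ u ∈ (siteLoopConfig δ ω).loops, u.nestingPhase f ^ 2)) ∂(triSitePercolation half) : ℝ) : ℂ) := by
  rw [cf_iteratedDeriv_eq_integral f R C hf hC hR h0 δ hδ 2 0, ← integral_complex_ofReal]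
  refine integral_congr_ae (Eventually.of_forall fun ω ↦ ?_)
  exact cf_iteratedDeriv_two_finprod f R hR h0 _ (ncard_loops_siteLoopConfig_meeting_le hδ R ω).1

/-! ## The registered sub-goal -/

/-- **Sub-goal SO (`so_secondOrder_of_twoPoint`) · order `2` of the coefficient identification from the
two-point power-sum limit.**  If `E_{1/2}[3A₁² − 4A₂] → (3/2π²) ∬ log‖x − y‖ f(x) f(y)` as `δ → 0⁺`, then any
limit `a` of `Φ_δ''(0)` along `δ → 0⁺` is `G_f''(0) = 2 q(f)`, `G_f(t) = exp(q(f) t²)`,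
`q(f) = (3/4π²) ∬ log‖x − y‖ f(x) f(y)`: along `𝓝[>] 0` one has `δ > 0`, where
`Φ_δ''(0) = E_{1/2}[3A₁² − 4A₂]` (`so_iteratedDeriv_two_eq_ofReal_integral`); conclude by continuity of
`ℝ → ℂ`, uniqueness of limits, and `(exp(c t²))''(0) = 2c`. -/
theorem so_secondOrder_of_twoPoint : ∀ (f : ℂ → ℝ) (R C : ℝ), Measurable f → (∀ z, |f z| ≤ C) →
    (∀ z, R < ‖z‖ → f z = 0) → ∫ z, f z = 0 →
    Tendsto (fun δ : ℝ ↦ ∫ ω, (3 * (∑ᶠ u ∈ (siteLoopConfig δ ω).loops, u.nestingPhase f) ^ 2 -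
      4 * (∑ᶠ u ∈ (siteLoopConfig δ ω).loops, u.nestingPhase f ^ 2)) ∂(triSitePercolation half))
      (𝓝[>] (0 : ℝ)) (𝓝 (3 / (2 * π ^ 2) * ∫ x, ∫ y, Real.log ‖x - y‖ * f x * f y)) →
    ∀ a : ℂ, Tendsto (fun δ : ℝ ↦ iteratedDeriv 2 (fun t : ℂ ↦ ∫ ω, (∏ᶠ u ∈ (siteLoopConfig δ ω).loops,
      2 * Complex.cos (t * ((u.nestingPhase f : ℝ) : ℂ) + (Real.pi : ℂ) / 3)) ∂(triSitePercolation half)) 0)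
      (𝓝[>] (0 : ℝ)) (𝓝 a) →
    a = iteratedDeriv 2 (fun t : ℂ ↦ Complex.exp
      (((3 / (4 * π ^ 2) * ∫ x, ∫ y, Real.log ‖x - y‖ * f x * f y : ℝ) : ℂ) * t ^ 2)) 0 := by
  intro f R C hf hC hR h0 hlim a ha
  have hlimC : Tendsto (fun δ : ℝ ↦ iteratedDeriv 2 (fun t : ℂ ↦ ∫ ω, (∏ᶠ u ∈ (siteLoopConfig δ ω).loops,
      2 * Complex.cos (t * ((u.nestingPhase f : ℝ) : ℂ) + (Real.pi : ℂ) / 3)) ∂(triSitePercolation half)) 0)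
      (𝓝[>] (0 : ℝ)) (𝓝 (((3 / (2 * π ^ 2) * ∫ x, ∫ y, Real.log ‖x - y‖ * f x * f y : ℝ) : ℂ))) := by
    refine Tendsto.congr' ?_ ((Complex.continuous_ofReal.tendsto _).comp hlim)
    filter_upwards [self_mem_nhdsWithin] with δ hδ
    exact (so_iteratedDeriv_two_eq_ofReal_integral hf hC hR h0 (mem_Ioi.1 hδ)).symm
  rw [tendsto_nhds_unique ha hlimC, so_iteratedDeriv_two_cexp_mul_sq]
  push_cast
  ring

end Summit.CriticalPhenomena.CardyFormulaZ2.Cruxes.MagicFormulaT.LineSketch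

end
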